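import Literature.NumberTheory.GaloisRepresentations.LocalDualityTheorem
import Literature.NumberTheory.GaloisRepresentations.CoinducedDiscreteGaloisModule
import Literature.NumberTheory.GaloisRepresentations.ContinuousShapiroLiftCupAdjoint
import Literature.NumberTheory.GaloisRepresentations.ContinuousShapiroLiftCores
import Literature.NumberTheory.GaloisRepresentations.ContinuousShapiroOpenCoinducedDescent
import Literature.NumberTheory.GaloisRepresentations.TateDualityCounting
import HarnessLib

/-!
# Local Tate duality for an OPEN SUBGROUP of `Γ_F` in the Shapiro model, LOCAL coefficients, and the
# self-annihilation of a LAGRANGIAN local condition (Milne I Cor. 2.3 at a finite layer; NSW (1.6.4), (7.2.6))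

Generic local Galois cohomology; namespace `Literature.NumberTheory.GaloisRepresentations`. THEOREMS ONLY (no definition, no
named fact, no instance, no notation, no `sorry`).

Let `F` be a non-archimedean local field of characteristic `0`, `Γ_F` its absolute Galois group, `U ≤ Γ_F` an OPEN subgroup of
finite index (the absolute Galois group of a finite extension `L = F̄^U`, kept inside `Γ_F`), `N ≥ 1`, and `A`, `A'` FINITE discrete
`Γ_F`-modules — genuinely LOCAL modules (e.g. the kernel of reduction `C ⊂ E[p^k]` of an ordinary elliptic curve over `ℚ_p` and
`E[p^k]/C`), not restrictions of global ones — with a `Γ_F`-equivariant pairing `B : A × A' → μ_N(F̄)` which is PERFECT on the right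
(`a' ↦ B(·, a')` is a bijection `A' ≃ Hom(A, μ_N)`) and `N • A = 0`. The Shapiro model of the local Tate pairing of `L` is

  `H¹(U, A) × H¹(U, A') → H²(Γ_F, μ_N)`,  `(x, y) ↦ Sh_U x ∪_{ΣB} Sh_U y`

(`shapiroLift` to `H¹(Γ_F, Maps(Γ_F ⧸ U, ·))` and the summed pairing `(pairing … B).coindFin U` of `ContinuousShapiroLiftPairing.lean`).

* §1 **`eq_zero_of_forall_cupProduct_coindFin_shapiroLift_eq_zero`** — RIGHT NON-DEGENERACY: if `Sh x ∪_{ΣB} Sh y = 0` for every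
  `x ∈ H¹(U, A)` then `y = 0`. Proof: local Tate duality for the `Γ_F`-module `Maps(Γ_F ⧸ U, A)` (`localDuality_bijective`, Serre II §5.2
  Thm. 2, with ITS injective `ι : H²(Γ_F, μ_N) ↪ ℤ/N` — irrelevant for a vanishing statement), the summed duality morphism
  `Ψ : Maps(Γ_F ⧸ U, A') ⥲ Maps(Γ_F ⧸ U, A)^D` (`coindTateDualMor`, bijective by `coindTateDualHom_bijective`; its module identity
  `tateDualPairing_toLin_coindTateDualMor`, and `tateDualPairing = evalPairing` definitionally), Shapiro surjectivity on `A` and injectivity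
  on `A'`.
* §2 **`cohomologyMap_eq_zero_of_forall_cupProduct_shapiroLift_range_eq_zero`** — LAGRANGIAN ⟹ SELF-ANNIHILATING: for finite discrete
  `Γ_F`-modules `C —ι→ X —π→ Q` with a self-pairing `e : X × X → μ_N` and a right-perfect `e' : C × Q → μ_N` such that
  `e(ι c, x) = e'(c, π x)` (i.e. `ι(C)` is its own annihilator for `e` and `Q = X/ι(C)`), and `N • C = 0`: every `b ∈ H¹(U, X)` with
  `Sh(H¹(ι) c) ∪_{Σe} Sh b = 0` for all `c ∈ H¹(U, C)` satisfies `H¹(π) b = 0` — the annihilator of the image of `H¹(U, C)` under the layer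
  Tate pairing is contained in the kernel of `H¹(U, X) → H¹(U, Q)` (= that image, by exactness). Proof: §1 for `(C, Q, e')` after the
  mixed naturality `shapiroLift_cupProduct_coindFin_map_adjoint`.

Consumer (why). The Greenberg (ordinary) local condition `Im(H¹(L, C_v) → H¹(L, E[p^∞]))` at a layer `L = ℚ_{n,𝔭}` of the cyclotomic
tower, cut to level `p^k`, is SELF-DUAL under the local Tate pairing because `C_v` is Lagrangian for the Weil pairing; §2 is that
statement in the Shapiro model used by the tree's levelwise Poitou–Tate calls (`Maps(Γ_ℚ ⧸ Γ_n, E[p^k])`, one orbit at `p`) — the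
dual-side input at `p` of the kernel proof of Greenberg's Lemma 4.6 on `Γ`-invariants (`Greenberg1999.lemma46_gammaInvariants_auxPlace_rat`;
cell `bsd-2adic`, item stmt-BirchSwinnertonDyer-19271, seat `bsd-2adic-tower-1` GEN 34, brick B2/B3 of the road-C′ note). Over a GLOBAL module
restricted to a place the tree already has this non-degeneracy (`layerPairingH1Of_bijective`); the point here is LOCAL coefficients.
HONEST FRAMING: local Galois cohomology bookkeeping; nothing about any curve or about BSD is proved here.

## References
* J. S. Milne, *Arithmetic Duality Theorems*, 2nd ed. (2006), I Cor. 2.3, I §6 (proof of Prop. 6.9). [MilneADT2006]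
* J.-P. Serre, *Galois Cohomology* (1997), II §5.2 Thm. 2; I §2.5. [SerreGaloisCohomology1997]
* J. Neukirch, A. Schmidt, K. Wingberg, *Cohomology of Number Fields*, 2nd ed. (2008), I §6 (1.6.4), VII (7.2.6). [NeukirchSchmidtWingberg2008]
* R. Greenberg, *Iwasawa theory for elliptic curves*, LNM 1716 (1999), §2 pp. 73–75 (`C_v`, Prop. 2.2/2.4). [GreenbergLNM1716]
-/

noncomputable section

open CategoryTheory Function Field

universe u w

namespace Literature.NumberTheory.GaloisRepresentations

open _root_.TopRep _root_.ContinuousCohomology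
open Literature.NumberTheory.GaloisRepresentations.DiscreteGaloisModule

/-! ## §0 A bijective morphism of discrete representations is bijective on cohomology -/

section Bijective

variable {k : Type w} [CommRing k] [TopologicalSpace k] {G : Type u} [Group G] [TopologicalSpace G]
  [IsTopologicalGroup G] {X Y : TopRep.{u} k G} [DiscreteTopology X] [DiscreteTopology Y]

/-- A bijective morphism of DISCRETE topological representations induces bijections on continuous cohomology (its inverse is
automatically continuous: `topRepIsoOfEquiv`, `continuousCohomologyEquivOfIso`). [cite: NeukirchSchmidtWingberg2008, I §3] -/
theorem bijective_cohomologyMap_of_bijective_of_discrete (f : X ⟶ Y) (hf : Bijective f.hom) (q : ℕ) :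
    Bijective (cohomologyMap f q) := by
  let e : X ≃L[k] Y :=
    { (LinearEquiv.ofBijective f.hom.toContinuousLinearMap.toLinearMap hf) with
      continuous_toFun := continuous_of_discreteTopology
      continuous_invFun := continuous_of_discreteTopology }
  have he : ∀ (g : G) (x : X), e (X.ρ g x) = Y.ρ g (e x) := fun g x => TopRep.hom_comm_apply f g x
  have hhom : (topRepIsoOfEquiv e he).hom = f := rfl
  rw [← hhom]
  exact (continuousCohomologyEquivOfIso (topRepIsoOfEquiv e he) q).bijective

end Bijective

/-! ## §1 Right non-degeneracy of the layer Tate pairing in the Shapiro model, local coefficients -/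

section NonDegenerate

variable (F : Type u) [Field F] [ValuativeRel F] [TopologicalSpace F] [IsNonarchimedeanLocalField F] [CharZero F]
variable {A A' : Type u} [AddCommGroup A] [TopologicalSpace A] [DiscreteTopology A] [Finite A]
  [AddCommGroup A'] [TopologicalSpace A'] [DiscreteTopology A'] [Finite A']
variable (ρA : DiscreteGaloisModule F A) (ρA' : DiscreteGaloisModule F A')
variable (U : Subgroup (absoluteGaloisGroup F)) [Fintype (absoluteGaloisGroup F ⧸ U)]
  (hU : IsOpen (U : Set (absoluteGaloisGroup F))) {s : absoluteGaloisGroup F ⧸ U → absoluteGaloisGroup F}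
  (hs : ∀ x, (s x : absoluteGaloisGroup F ⧸ U) = x) (hs1 : s ((1 : absoluteGaloisGroup F) : absoluteGaloisGroup F ⧸ U) = 1)
variable {N : ℕ} [NeZero N] (B : A →+ A' →+ MuCarrier F N)
  (hB : ∀ (σ : absoluteGaloisGroup F) (a : A) (a' : A'), B (ρA σ a) (ρA' σ a') = mu F N σ (B a a'))

omit [Finite A'] in
/-- **Local Tate duality at a finite layer, Shapiro model, local coefficients — right non-degeneracy.** Let `F` be a char-`0`
non-archimedean local field, `U ≤ Γ_F` open of finite index, `A`, `A'` finite discrete `Γ_F`-modules with an equivariant pairing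
`B : A × A' → μ_N` PERFECT ON THE RIGHT (`a' ↦ B(·,a')` bijective onto `Hom(A, μ_N)`), `N • A = 0`. If `y ∈ H¹(U, A')` has
`Sh_U x ∪_{ΣB} Sh_U y = 0` in `H²(Γ_F, μ_N)` for every `x ∈ H¹(U, A)`, then `y = 0`. (Local duality for `Maps(Γ_F ⧸ U, A)` over `F`,
`localDuality_bijective`, transported through `Ψ = coindTateDualMor` and the Shapiro lifts.) [cite: MilneADT2006, Ch. I Cor. 2.3]
[cite: SerreGaloisCohomology1997, II §5.2 Thm. 2] [cite: NeukirchSchmidtWingberg2008, I §6 Prop. (1.6.4)] -/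
theorem eq_zero_of_forall_cupProduct_coindFin_shapiroLift_eq_zero (hBbij : Bijective fun a' : A' => B.flip a')
    (hN : ∀ a : A, N • a = 0) (y : continuousCohomology 1 (subgroupRep ρA'.toTopRep U))
    (hy : ∀ x : continuousCohomology 1 (subgroupRep ρA.toTopRep U),
      ((pairing ρA ρA' (mu F N) B hB).coindFin U).cupProduct (shapiroLift ρA.toTopRep U hU hs hs1 x)
        (shapiroLift ρA'.toTopRep U hU hs hs1 y) = 0) :
    y = 0 := by
  classical
  have hMI : ∀ φ : absoluteGaloisGroup F ⧸ U → A, N • φ = 0 := fun φ => funext fun z => hN (φ z)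
  obtain ⟨ι, -, -, hbf⟩ := localDuality_bijective F (ρA.coind U hU) hMI
  -- `Ψ : Maps(Γ_F ⧸ U, A') → Maps(Γ_F ⧸ U, A)^D`, typed into the `Hom(·, μ_N)`-model of `localDuality_bijective`
  -- (`tateDual = homRep μ_N` and `tateDualPairing = evalPairing μ_N` definitionally)
  let Ψ : coindFin.{0, u} ρA'.toTopRep U ⟶ ((ρA.coind U hU).homRep (mu F N)).toTopRep :=
    coindTateDualMor ρA ρA' U B hU hB
  have hΨc : ∀ (φ : absoluteGaloisGroup F ⧸ U → A) (ψ : absoluteGaloisGroup F ⧸ U → A'),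
      ((ρA.coind U hU).evalPairing (mu F N)).toLin φ (Ψ.hom ψ) =
        ((pairing ρA ρA' (mu F N) B hB).coindFin U).toLin φ ψ :=
    fun φ ψ => tateDualPairing_toLin_coindTateDualMor ρA ρA' U B hU hB φ ψ
  set Y : continuousCohomology 1 ((ρA.coind U hU).homRep (mu F N)).toTopRep :=
    cohomologyMap Ψ 1 (shapiroLift ρA'.toTopRep U hU hs hs1 y) with hYdef
  -- the evaluation pairing, read on the tree's `coindFin` (`toTopRep_coind` is `rfl`)
  let P₂ : ContPairing (coindFin.{0, u} ρA.toTopRep U) ((ρA.coind U hU).homRep (mu F N)).toTopRep (mu F N).toTopRep :=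
    (ρA.coind U hU).evalPairing (mu F N)
  -- `⟨Sh x, Y⟩ = Sh x ∪_{ΣB} Sh y` (on cocycles: `ev(f σ, Ψ(g(στ) - g σ)) = ΣB(f σ, g(στ) - g σ)`)
  have key : ∀ x : continuousCohomology 1 (subgroupRep ρA.toTopRep U),
      P₂.cupProduct (shapiroLift ρA.toTopRep U hU hs hs1 x) Y =
        ((pairing ρA ρA' (mu F N) B hB).coindFin U).cupProduct (shapiroLift ρA.toTopRep U hU hs hs1 x)
          (shapiroLift ρA'.toTopRep U hU hs hs1 y) := by
    intro x
    obtain ⟨f, hf⟩ := oneCocycleClass_surjective _ (shapiroLift ρA.toTopRep U hU hs hs1 x)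
    obtain ⟨g, hg⟩ := oneCocycleClass_surjective _ (shapiroLift ρA'.toTopRep U hU hs hs1 y)
    rw [hYdef, ← hf, ← hg, cohomologyMap_oneCocycleClass, ContPairing.cupProduct_oneCocycleClass_eq_twoCocycleClass,
      ContPairing.cupProduct_oneCocycleClass_eq_twoCocycleClass]
    congr 1
    refine Subtype.ext (ContinuousMap.ext fun p => ?_)
    obtain ⟨σ, τ⟩ := p
    rw [ContPairing.cupCocycle_apply, ContPairing.cupCocycle_apply, pullback_id_resIdHom_apply,
      pullback_id_resIdHom_apply, ← map_sub]
    exact hΨc _ _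
  -- the flip functional of `Y` vanishes, hence `Y = 0` by local duality for `Maps(Γ_F ⧸ U, A)`
  have hflip : ((ρA.coind U hU).dualityPairing (mu F N) ι).flip Y =
      ((ρA.coind U hU).dualityPairing (mu F N) ι).flip 0 := by
    refine AddMonoidHom.ext fun X => ?_
    obtain ⟨x, rfl⟩ := shapiroLift_surjective ρA.toTopRep U hU hs hs1 X
    rw [AddMonoidHom.flip_apply, AddMonoidHom.flip_apply, ContinuousRep.dualityPairing_apply,
      ContinuousRep.dualityPairing_apply, map_zero, map_zero]
    change ι (P₂.cupProduct (shapiroLift ρA.toTopRep U hU hs hs1 x) Y) = 0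
    rw [key x, hy x, map_zero]
  have hY : Y = 0 := hbf.1 hflip
  -- `Ψ` is bijective on `H¹`, and the Shapiro lift is injective
  haveI : DiscreteTopology (coindFin.{0, u} ρA'.toTopRep U) :=
    inferInstanceAs (DiscreteTopology (absoluteGaloisGroup F ⧸ U → A'))
  haveI : DiscreteTopology ((ρA.coind U hU).homRep (mu F N)).toTopRep :=
    inferInstanceAs (DiscreteTopology (HomCarrier (absoluteGaloisGroup F ⧸ U → A) (MuCarrier F N)))
  have hΨ : Injective (cohomologyMap Ψ 1) :=
    (bijective_cohomologyMap_of_bijective_of_discrete Ψ (coindTateDualHom_bijective U B hBbij) 1).1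
  have hSh : shapiroLift ρA'.toTopRep U hU hs hs1 y = 0 := hΨ (by rw [map_zero, ← hYdef, hY])
  exact shapiroLift_injective ρA'.toTopRep U hU hs hs1 (by rw [hSh, map_zero])

end NonDegenerate

/-! ## §2 A Lagrangian local condition is self-annihilating at every layer -/

section Lagrangian

variable (F : Type u) [Field F] [ValuativeRel F] [TopologicalSpace F] [IsNonarchimedeanLocalField F] [CharZero F]
variable {C X Q : Type u} [AddCommGroup C] [TopologicalSpace C] [DiscreteTopology C] [Finite C]
  [AddCommGroup X] [TopologicalSpace X] [DiscreteTopology X] [Finite X]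
  [AddCommGroup Q] [TopologicalSpace Q] [DiscreteTopology Q] [Finite Q]
variable (ρC : DiscreteGaloisModule F C) (ρX : DiscreteGaloisModule F X) (ρQ : DiscreteGaloisModule F Q)
variable (ιC : ρC.toTopRep ⟶ ρX.toTopRep) (π : ρX.toTopRep ⟶ ρQ.toTopRep)
variable (U : Subgroup (absoluteGaloisGroup F)) [Fintype (absoluteGaloisGroup F ⧸ U)]
  (hU : IsOpen (U : Set (absoluteGaloisGroup F))) {s : absoluteGaloisGroup F ⧸ U → absoluteGaloisGroup F}
  (hs : ∀ x, (s x : absoluteGaloisGroup F ⧸ U) = x) (hs1 : s ((1 : absoluteGaloisGroup F) : absoluteGaloisGroup F ⧸ U) = 1)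
variable {N : ℕ} [NeZero N] (e : X →+ X →+ MuCarrier F N)
  (he : ∀ (σ : absoluteGaloisGroup F) (x x' : X), e (ρX σ x) (ρX σ x') = mu F N σ (e x x'))
  (e' : C →+ Q →+ MuCarrier F N)

omit [Finite X] [Finite Q] in
/-- **A Lagrangian local condition annihilates only itself, at every layer (Shapiro model).** Let `C —ι→ X —π→ Q` be finite
discrete `Γ_F`-modules, `e : X × X → μ_N` an equivariant pairing and `e' : C × Q → μ_N` an equivariant pairing PERFECT ON THE RIGHT
with `e(ι c, x) = e'(c, π x)` for all `c`, `x` (so `ι(C)` is orthogonal exactly to `ker π ⊇ ι(C)`: a Lagrangian when `Q = X/ι(C)`),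
`N • C = 0`. Then for `b ∈ H¹(U, X)`: if `Sh_U(H¹(ι) c) ∪_{Σe} Sh_U b = 0` for every `c ∈ H¹(U, C)`, then `H¹(π) b = 0` in `H¹(U, Q)`
— i.e. `b` lies in `ker(H¹(U, X) → H¹(U, Q))`, the image of `H¹(U, C)` by exactness. (Mixed naturality
`shapiroLift_cupProduct_coindFin_map_adjoint` turns the hypothesis into `Sh c ∪_{Σe'} Sh(H¹(π) b) = 0`, then §1 for `(C, Q, e')`.) Model
case: `X = E[p^k]` over `ℚ_p` for an ordinary curve, `C` the kernel of reduction (cyclic of order `p^k`, isotropic for the Weil pairing),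
`Q = E[p^k]/C ≅ Ẽ[p^k]`: Greenberg's local condition at a layer of the cyclotomic tower is its own annihilator under the layer Tate
pairing. [cite: GreenbergLNM1716, §2 pp. 73–75] [cite: MilneADT2006, Ch. I Cor. 2.3] [cite: NeukirchSchmidtWingberg2008, I §6 Prop. (1.6.4)] -/
theorem cohomologyMap_eq_zero_of_forall_cupProduct_shapiroLift_range_eq_zero
    (he' : ∀ (σ : absoluteGaloisGroup F) (c : C) (q : Q), e' (ρC σ c) (ρQ σ q) = mu F N σ (e' c q))
    (he'bij : Bijective fun q : Q => e'.flip q) (hcompat : ∀ (c : C) (x : X), e (ιC.hom c) x = e' c (π.hom x))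
    (hN : ∀ c : C, N • c = 0) (b : continuousCohomology 1 (subgroupRep ρX.toTopRep U))
    (hb : ∀ c : continuousCohomology 1 (subgroupRep ρC.toTopRep U),
      ((pairing ρX ρX (mu F N) e he).coindFin U).cupProduct
        (shapiroLift ρX.toTopRep U hU hs hs1 (cohomologyMap (subgroupRepMap ιC U) 1 c))
        (shapiroLift ρX.toTopRep U hU hs hs1 b) = 0) :
    cohomologyMap (subgroupRepMap π U) 1 b = 0 := by
  refine eq_zero_of_forall_cupProduct_coindFin_shapiroLift_eq_zero F ρC ρQ U hU hs hs1 e' he' he'bij hN _ fun c => ?_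
  have h := shapiroLift_cupProduct_coindFin_map_adjoint (pairing ρX ρX (mu F N) e he) (pairing ρC ρQ (mu F N) e' he')
    ιC π (𝟙 _) U hU hs hs1 (fun c x => by
      change (pairing ρX ρX (mu F N) e he).toLin (ιC.hom c) x = (pairing ρC ρQ (mu F N) e' he').toLin c (π.hom x)
      rw [pairing_toLin_apply, pairing_toLin_apply, hcompat]) c b
  rw [cohomologyMap_id_apply, hb c] at h
  exact h.symm

end Lagrangian

end Literature.NumberTheory.GaloisRepresentations

end
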